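import Literature.Barriers.PneNP.TSPExtensionComplexityProofs
import Literature.Barriers.PneNP.TSPExtensionComplexityFactorization
import Literature.Barriers.PneNP.TSPExtensionComplexityMatchingsOps
import Mathlib.Analysis.Convex.Hull
import HarnessLib

/-!
# The perfect matching polytope and its odd-cut slack matrix

Support file for the discharge of `Literature.Barriers.PneNP.Rothvoss2017_tsp` (Rothvoß 2017).
"The perfect matching polytope `P_PM` [is] the convex hull of all characteristic vectors of
perfect matchings in a complete `n`-node graph" (§1, PDF p. 4); Rothvoß's lower bound is read
off "the part of the slack matrix that is induced by the odd set inequalities ...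
`S_{UM} = |M ∩ δ(U)| - 1`" (§2, PDF p. 5) through the hyperplane separation bound (Lemma 5).
This file sets up exactly that interface, all proved:

* `pmPolytope n ⊆ ℝ^{E(K_n)}` (Mathlib's `convexHull`, same coordinates as `tspPolytope n`);
* the odd-cut functionals `oddCutVec U` (`-1` on the edges with exactly one endpoint in `U`):
  on a perfect matching `M` they evaluate to `-|δ(U) ∩ M|` (`oddCutVec_dotProduct_charVec`),
  so `oddCutVec U · x ≤ -1` is VALID on `pmPolytope n` for `|U|` odd (`oddCutVec_le`, Edmonds'
  odd-set inequalities, by the parity lemma of `…MatchingsOps.lean` and convexity), with slack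
  `|δ(U) ∩ M| - 1 ∈ [0, |U| - 1]` at `χ^M`;
* `HasEFOfSize.pm_hyperplane_separation` — Rothvoß's Lemma 5 specialised to this slack
  matrix: if `PM(n)` has an EF with `r` inequalities, then for every weight matrix `W` on
  (`t`-subsets `U`) × (perfect matchings `M`) whose rectangle sums are all `≤ α`,
  `Σ_{U,M} W_{UM} (|δ(U) ∩ M| - 1) ≤ (r + 1) · (t - 1) · α`. The combinatorial core of the paper
  (Lemma 6: such a `W` with `⟨W,S⟩ = 1` and `α = 2^{-Ω(n)}`) is the sibling files
  `…Rothvoss*.lean`.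

Also: points of `tspPolytope`/`pmPolytope` are nonnegative (`0/1` hulls), used by the
face/projection step.
-/

noncomputable section

namespace Literature.Barriers.PneNP

open Finset Matrix

variable {n : ℕ}

/-! ### The polytope -/

/-- **The perfect matching polytope** `P_PM(n) = conv{χ^M ∈ ℝ^E | M ⊆ E perfect matching}` of
the complete graph on `Fin n` (coordinates: the edges of `⊤ : SimpleGraph (Fin n)`, as for
`tspPolytope`). [cite: Rothvoss2017, §1 (PDF p. 4)] -/
def pmPolytope (n : ℕ) : Set ((⊤ : SimpleGraph (Fin n)).edgeSet → ℝ) :=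
  convexHull ℝ {x | ∃ M : Finset (Sym2 (Fin n)), IsPMOn Finset.univ M ∧ x = charVec M}

/-- Characteristic vectors of perfect matchings lie in the polytope. [folklore] -/
theorem charVec_mem_pmPolytope {M : Finset (Sym2 (Fin n))} (hM : IsPMOn Finset.univ M) :
    charVec M ∈ pmPolytope n :=
  subset_convexHull ℝ _ ⟨M, hM, rfl⟩

/-- Edges of a perfect matching are edges of the complete graph. [folklore] -/
theorem IsPMOn.mem_edgeSet_top {V : Type*} [DecidableEq V] {S : Finset V} {M : Finset (Sym2 V)}
    (hM : IsPMOn S M) {e : Sym2 V} (he : e ∈ M) : e ∈ (⊤ : SimpleGraph V).edgeSet := by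
  rw [SimpleGraph.edgeSet_top]
  exact hM.not_isDiag he

/-- A convex hull of nonnegative vectors is nonnegative. [folklore] -/
theorem convexHull_nonneg {ι : Type*} {S : Set (ι → ℝ)} (hS : ∀ x ∈ S, ∀ i, 0 ≤ x i) :
    ∀ x ∈ convexHull ℝ S, ∀ i, 0 ≤ x i := by
  intro x hx
  have hconv : Convex ℝ {y : ι → ℝ | ∀ i, 0 ≤ y i} := by
    intro y hy z hz a b ha hb _ i
    simp only [Pi.add_apply, Pi.smul_apply, smul_eq_mul]
    exact add_nonneg (mul_nonneg ha (hy i)) (mul_nonneg hb (hz i))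
  exact convexHull_min hS hconv hx

/-- Characteristic vectors are nonnegative. [folklore] -/
theorem charVec_nonneg {N : ℕ} (F : Finset (Sym2 (Fin N))) (ε : (⊤ : SimpleGraph (Fin N)).edgeSet) :
    0 ≤ charVec F ε := by
  unfold charVec
  split_ifs <;> norm_num

/-- Points of the TSP polytope are nonnegative vectors. [folklore] -/
theorem tspPolytope_nonneg {N : ℕ} : ∀ x ∈ tspPolytope N, ∀ ε, 0 ≤ x ε := by
  refine convexHull_nonneg ?_
  rintro x ⟨F, -, rfl⟩ ε
  exact charVec_nonneg F ε

/-- Points of the perfect matching polytope are nonnegative vectors. [folklore] -/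
theorem pmPolytope_nonneg : ∀ x ∈ pmPolytope n, ∀ ε, 0 ≤ x ε := by
  refine convexHull_nonneg ?_
  rintro x ⟨M, -, rfl⟩ ε
  exact charVec_nonneg M ε

/-! ### Odd-cut functionals and their slacks -/

/-- The odd-cut functional of `U`: coefficient `-1` on the edges with exactly one endpoint in
`U` (so that `oddCutVec U · x ≤ -1` reads `x(δ(U)) ≥ 1`). [cite: Rothvoss2017, §1 (PDF p. 4)] -/
def oddCutVec (U : Finset (Fin n)) : (⊤ : SimpleGraph (Fin n)).edgeSet → ℝ :=
  fun ε => if cutCount U (ε : Sym2 (Fin n)) = 1 then -1 else 0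

/-- On a perfect matching `M`, the odd-cut functional of `U` evaluates to `-|δ(U) ∩ M|`.
[cite: Rothvoss2017, §2 (PDF p. 5)] -/
theorem oddCutVec_dotProduct_charVec (U : Finset (Fin n)) {M : Finset (Sym2 (Fin n))}
    (hM : IsPMOn Finset.univ M) :
    oddCutVec U ⬝ᵥ charVec M = -((M.filter fun e => cutCount U e = 1).card : ℝ) := by
  have h1 := dotProduct_charVec (fun e => if cutCount U e = 1 then (-1 : ℝ) else 0) M
    (fun e he => hM.mem_edgeSet_top he)
  rw [show (fun ε : (⊤ : SimpleGraph (Fin n)).edgeSet =>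
      (fun e => if cutCount U e = 1 then (-1 : ℝ) else 0) (ε : Sym2 (Fin n))) = oddCutVec U
      from rfl] at h1
  rw [h1]
  rw [← sum_filter, sum_const, nsmul_eq_mul, mul_neg, mul_one]

/-- **The odd-set inequalities are valid on the perfect matching polytope**: for `|U|` odd,
`oddCutVec U · x ≤ -1` (i.e. `x(δ(U)) ≥ 1`) for all `x ∈ P_PM(n)`.
[cite: Rothvoss2017, §1 (PDF p. 4)] -/
theorem oddCutVec_le (U : Finset (Fin n)) (hU : Odd U.card) :
    ∀ x ∈ pmPolytope n, oddCutVec U ⬝ᵥ x ≤ -1 := by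
  intro x hx
  have hconv : Convex ℝ {y : (⊤ : SimpleGraph (Fin n)).edgeSet → ℝ | oddCutVec U ⬝ᵥ y ≤ -1} := by
    refine convex_halfSpace_le ⟨fun y z => dotProduct_add _ _ _, fun t y => ?_⟩ (-1)
    rw [dotProduct_smul, smul_eq_mul]
  refine (convexHull_min ?_ hconv) hx
  rintro y ⟨M, hM, rfl⟩
  show oddCutVec U ⬝ᵥ charVec M ≤ -1
  rw [oddCutVec_dotProduct_charVec U hM]
  have := hM.one_le_card_cut (subset_univ U) hU
  have : (1 : ℝ) ≤ ((M.filter fun e => cutCount U e = 1).card : ℝ) := by exact_mod_cast this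
  linarith

/-- The slack of the odd-cut inequality of `U` at `χ^M` is `|δ(U) ∩ M| - 1`.
[cite: Rothvoss2017, §2 (PDF p. 5)] -/
theorem oddCut_slack (U : Finset (Fin n)) {M : Finset (Sym2 (Fin n))}
    (hM : IsPMOn Finset.univ M) :
    (-1 : ℝ) - oddCutVec U ⬝ᵥ charVec M = ((M.filter fun e => cutCount U e = 1).card : ℝ) - 1 := by
  rw [oddCutVec_dotProduct_charVec U hM]
  ring

/-! ### The hyperplane separation bound for the odd-cut slack matrix -/

/-- **Rothvoß's Lemma 5 for the odd-cut slack matrix of `P_PM(n)`.** Let `t ≥ 1` be odd and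
let `W` be any real matrix indexed by the `t`-element vertex sets `U` and the perfect matchings
`M` of `K_n`, such that every combinatorial rectangle `𝒰 × ℳ` has `Σ_{U ∈ 𝒰, M ∈ ℳ} W_{UM} ≤ α`.
If `P_PM(n)` has an extended formulation with `r` inequalities, then
`Σ_{U,M} W_{UM} · (|δ(U) ∩ M| - 1) ≤ (r + 1) · (t - 1) · α` ("`xc(P) ≥ ⟨W,S⟩/(‖S‖_∞ · α)`" with
`‖S‖_∞ ≤ t - 1` here, and `r + 1` for `r` from the factorization's constant term).
[cite: Rothvoss2017, Lemma 5 (PDF p. 6) and §2 (PDF pp. 5–6)] -/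
theorem HasEFOfSize.pm_hyperplane_separation {r t : ℕ} (ht : Odd t)
    (h : HasEFOfSize (pmPolytope n) r)
    (W : {U : Finset (Fin n) // U.card = t} → {M : Finset (Sym2 (Fin n)) // IsPMOn univ M} → ℝ)
    (α : ℝ)
    (hα : ∀ (X : Finset {U : Finset (Fin n) // U.card = t})
      (Y : Finset {M : Finset (Sym2 (Fin n)) // IsPMOn univ M}),
      ∑ a ∈ X, ∑ b ∈ Y, W a b ≤ α) :
    ∑ a, ∑ b, W a b * ((((b : Finset (Sym2 (Fin n))).filter
        fun e => cutCount (a : Finset (Fin n)) e = 1).card : ℝ) - 1) ≤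
      (r + 1) * ((t - 1 : ℕ) * α) := by
  classical
  have ht1 : 1 ≤ t := ht.pos
  have key := h.hyperplane_separation
    (A := {U : Finset (Fin n) // U.card = t}) (B := {M : Finset (Sym2 (Fin n)) // IsPMOn univ M})
    (fun b => charVec (b : Finset (Sym2 (Fin n)))) (fun b => charVec_mem_pmPolytope b.2)
    (fun a => oddCutVec (a : Finset (Fin n))) (fun _ => -1)
    (fun a => oddCutVec_le _ (by rw [a.2]; exact ht)) (s := ((t - 1 : ℕ) : ℝ)) (by positivity)
    (fun a b => by
      rw [oddCut_slack _ b.2]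
      have h1 := b.2.card_cut_le (subset_univ (a : Finset (Fin n)))
      rw [a.2] at h1
      have h2 : (((b : Finset (Sym2 (Fin n))).filter
          fun e => cutCount (a : Finset (Fin n)) e = 1).card : ℝ) ≤ ((t - 1 : ℕ) : ℝ) + 1 := by
        have : (((b : Finset (Sym2 (Fin n))).filter
            fun e => cutCount (a : Finset (Fin n)) e = 1).card : ℝ) ≤ (t : ℝ) := by
          exact_mod_cast h1
        have ht' : ((t - 1 : ℕ) : ℝ) + 1 = t := by
          rw [Nat.cast_sub ht1]; ring
        linarith
      linarith)
    W α hα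
  refine le_trans (le_of_eq ?_) key
  refine sum_congr rfl fun a _ => sum_congr rfl fun b _ => ?_
  rw [oddCut_slack _ b.2]

end Literature.Barriers.PneNP

end
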